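/-
Copyright (c) 2026 the pub-hodgecm-mathlib formalisation cell (harness21).  Prover seat hodgecm-mathlib-K2E2-p12 (g5): Track B «K2-LIT», ENGINE E1,
h413 = stmt-HodgeConjecture-24833; R8₂-sph ROAD T′, deal (92)∕(DISC) of K2E1-plan (g6) (letter (DISC) of K2E1-p12's T9 `…SphericalLine…`).
-/
import Summits.HodgeConjecture.HodgeConjecture.Theorems.K2E1CuspidalSpectrumUnitaryDefsR      -- ★ (K2E1-p02): `cmResidualSubspaceR`, `residualSubspace_le_discreteSpectrum`
import Literature.NumberTheory.Automorphic.HeckeEigenvectorProjection                          -- ★ `exists_isTopIrreducible_orthogonalProjectionOnto_ne_zero`, `orthogonalProjectionOnto_mem_fixedVectors`, inflate∕restrictLE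
import Literature.NumberTheory.Automorphic.HilbertRepDiscretePart                              -- ★ `isDiscretelyDecomposable_discretePart`, `isTopIrreducible_restrictLE`, `…_iff_orthogonal_discretePart_eq_bot`
import Literature.NumberTheory.Automorphic.HilbertRepOrthogonalDecomposition                   -- ★ `isAtomic_of_isDiscretelyDecomposable`, `eq_bot_of_le_of_le_orthogonal`, `ne_bot_of_isTopIrreducible`
import HarnessLib

/-!
# K2·E1 — `K2E1ResidualFixedVectorsDiscreteClosureU` (deal (92)∕(DISC)): THE `K`-FIXED VECTORS OF A CLOSED INVARIANT SUBSPACE OF THE DISCRETE PART — e.g. `L²_res(U(Φ_N))` — LIE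
# IN THE CLOSED SPAN OF THE `K`-FIXED VECTORS OF ITS IRREDUCIBLE CLOSED SUBREPRESENTATIONS [Dixmier §5.4; Bump Thm 3.6.1; MW I.2.18]

Track B ∕ K2-LIT, crux h413 = `stmt-HodgeConjecture-24833`, route of record `HCCMUnconditional`; cell `hodgecm-mathlib`, squad K2, ENGINE E1 (R8₂-sph ROAD T′; the (DISC) letter of T9).
THEOREMS ONLY (no `def`, no instance, no notation, no `sorry`; default heartbeats); lane `--supports stmt-HodgeConjecture-24833 --as helper` (count-neutral).  GENERIC over a unitary
representation `π` of a group `G` on a Hilbert space and a closed invariant `C ≤ π.discretePart`; ALL LETTER-FREE — neither Schur nor the `K`-averaging projector is needed: the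
irreducibles are found INSIDE `C` (atomicity of the discrete part ★, inflated along ★ `inflate`∕`restrictLE`), and the `K`-fixed components are the orthogonal projections ★
`orthogonalProjectionOnto_mem_fixedVectors`.
* §1 `exists_isTopIrreducible_le_of_le_discretePart (hπ) (hUD : U ≤ π.discretePart) (hU : U ≠ ⊥)` — every non-zero closed invariant subspace of the discrete part contains an irreducible.
* §2 **`isDiscretelyDecomposable_toContRep_of_le_discretePart (hπ) (hC : C ≤ π.discretePart)`** — `C` is the closed span of ITS OWN irreducible closed subrepresentations.
* §3 **`mem_closure_iSup_fixedVectors_of_le_discretePart (hπ) (hC) (K) (hφ : φ ∈ C.fixedVectors K)`** (HEAD): `(φ : H) ∈ closure (⨆_{W ≤ C irreducible} ι_W(W^K))` — `T :=` that closure is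
  contained in `C ∩ Fix K`, `ψ := φ − P_T φ ∈ C` is `K`-fixed and `⊥ T`; if `ψ ≠ 0`, ★ Bump's lemma gives an irreducible `W ≤ C` with `proj_W ψ ≠ 0`, but `proj_W ψ ∈ W^K ⊆ T` ★ forces
  `‖proj_W ψ‖² = ⟪ψ, proj_W ψ⟫ = 0`.
* §4 **`mem_closure_iSup_fixedVectors_cmResidualSubspaceR (L N μ K hφ)`** — the CM instance `C = L²_res(U(Φ_N))` (★ `residualSubspace_le_discreteSpectrum`, ★ `isUnitary_rightRegular`).
* §5 (ED. 2) `mem_closure_iSup_inf_of_le_discretePart`, **`cmResidualSubspaceR_fixed_mem_closure_iSup_inf`** — the same in T9's binder bytes (`K : S` set-like, `Kfix`∕`hKfix`, pieces `W.toSubmodule ⊓ Kfix`).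
HONEST LABEL: HC_CM is proved only modulo the 7 printed citations (2 remaining named inputs: hLiu418 = `stmt-HodgeConjecture-24832`, h413 = `stmt-HodgeConjecture-24833`) until rung 0
closes; this file asserts no named fact and closes no socket; count-neutral; unconditional Hilbert-space representation theory.

## References
* [Dixmier1977] J. Dixmier, *C\*-algebras* (1977): §5.4 (completely reducible representations and their subrepresentations), §13.1.
* [Bump1997] D. Bump, *Automorphic Forms and Representations* (1997): Thm. 3.6.1 (proof, pp. 340–342).
* [MoeglinWaldspurger1995] C. Mœglin, J.-L. Waldspurger, *Spectral Decomposition and Eisenstein Series* (1995): I.2.18 (`L²_res ≤ L²_disc`).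
-/

set_option autoImplicit false
set_option linter.dupNamespace false -- the mandated namespace repeats `HodgeConjecture.HodgeConjecture`

noncomputable section

open scoped InnerProductSpace
open MeasureTheory NumberField ContRepresentation ContRepresentation.ClosedSubrep
open Literature.NumberTheory.Automorphic Literature.NumberTheory.Automorphic.UnitaryGroup
open Summit.HodgeConjecture.HodgeConjecture.Cruxes.H413.K2E1CuspidalSpectrumUnitary (cmResidualSubspaceR)

namespace Summit.HodgeConjecture.HodgeConjecture.Cruxes.H413.K2E1ResidualFixedVectorsDiscreteClosureU

section Generic

variable {G H : Type*} [Group G] [NormedAddCommGroup H] [InnerProductSpace ℂ H] [CompleteSpace H] {π : ContRepresentation ℂ G H}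

/-! ## §1 Non-zero closed invariant subspaces of the discrete part contain irreducibles -/

/-- **A NON-ZERO CLOSED INVARIANT SUBSPACE OF THE DISCRETE PART OF A UNITARY REPRESENTATION CONTAINS AN IRREDUCIBLE CLOSED SUBREPRESENTATION** (the discrete part is discretely
decomposable ★, hence its lattice of closed subrepresentations is atomic ★; atoms inflate to irreducibles ★). [cite: Dixmier1977, §5.4] -/
theorem exists_isTopIrreducible_le_of_le_discretePart (hπ : π.IsUnitary) {U : ClosedSubrep π} (hUD : U ≤ π.discretePart) (hU : U ≠ ⊥) :
    ∃ W : ClosedSubrep π, W.toContRep.IsTopIrreducible ∧ W ≤ U := by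
  have hDu : π.discretePart.toContRep.IsUnitary := fun g => by
    have hu : IsUnit (π.discretePart.toContRep g) := (Group.isUnit g).map π.discretePart.toContRep.toMonoidHom
    refine hu.mem_unitary_of_star_mul_self ((π.discretePart.toContRep g).norm_map_iff_adjoint_comp_self.mp fun x => ?_)
    change ‖(π g x : H)‖ = ‖(x : H)‖
    exact hπ.norm_map g x
  haveI : IsAtomic (ClosedSubrep π.discretePart.toContRep) := hDu.isAtomic_of_isDiscretelyDecomposable isDiscretelyDecomposable_discretePart
  have hU' : π.discretePart.restrictLE U ≠ ⊥ := fun h0 => hU (by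
    rw [← π.discretePart.inflate_restrictLE hUD, h0, inflate_bot])
  obtain ⟨A, hA, hAle⟩ := (IsAtomic.eq_bot_or_exists_atom_le (π.discretePart.restrictLE U)).resolve_left hU'
  refine ⟨π.discretePart.inflate A, (π.discretePart.isTopIrreducible_inflate_iff A).2 ((isTopIrreducible_toContRep_iff_isAtom A).2 hA), ?_⟩
  calc π.discretePart.inflate A ≤ π.discretePart.inflate (π.discretePart.restrictLE U) := (π.discretePart.inflate_le_inflate_iff).2 hAle
    _ = U := π.discretePart.inflate_restrictLE hUD

/-! ## §2 Closed invariant subspaces of the discrete part are discretely decomposable -/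

/-- **A CLOSED INVARIANT SUBSPACE `C` OF THE DISCRETE PART IS THE CLOSED SPAN OF ITS OWN IRREDUCIBLE CLOSED SUBREPRESENTATIONS** (`C.toContRep.IsDiscretelyDecomposable`): otherwise the
orthogonal complement in `C` of that closed span is a non-zero closed invariant subspace of the discrete part, contains an irreducible `W` of `π` (§1), and `W` restricted to `C` is an
irreducible of `C.toContRep` orthogonal to all of them. [cite: Dixmier1977, §5.4] [cite: MoeglinWaldspurger1995, I.2.18] -/
theorem isDiscretelyDecomposable_toContRep_of_le_discretePart (hπ : π.IsUnitary) {C : ClosedSubrep π} (hC : C ≤ π.discretePart) :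
    C.toContRep.IsDiscretelyDecomposable := by
  have hCu : C.toContRep.IsUnitary := fun g => by
    have hu : IsUnit (C.toContRep g) := (Group.isUnit g).map C.toContRep.toMonoidHom
    refine hu.mem_unitary_of_star_mul_self ((C.toContRep g).norm_map_iff_adjoint_comp_self.mp fun x => ?_)
    change ‖(π g x : H)‖ = ‖(x : H)‖
    exact hπ.norm_map g x
  rw [isDiscretelyDecomposable_iff_orthogonal_discretePart_eq_bot hCu]
  by_contra hne
  set U₀ : ClosedSubrep C.toContRep := C.toContRep.discretePart.orthogonal hCu with hU₀
  have hU : C.inflate U₀ ≠ ⊥ := fun h0 => hne (C.inflate_injective (by rw [h0, inflate_bot]))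
  obtain ⟨W, hW, hWU⟩ := exists_isTopIrreducible_le_of_le_discretePart hπ ((C.inflate_le U₀).trans hC) hU
  have hWC : W ≤ C := hWU.trans (C.inflate_le U₀)
  have hW₀ : (C.restrictLE W).toContRep.IsTopIrreducible := C.isTopIrreducible_restrictLE hWC hW
  have h1 : C.restrictLE W ≤ C.toContRep.discretePart := le_discretePart hW₀
  have h2 : C.restrictLE W ≤ U₀ := by
    have h := C.restrictLE_mono hWU
    rwa [C.restrictLE_inflate] at h
  exact ne_bot_of_isTopIrreducible hW₀ (eq_bot_of_le_of_le_orthogonal hCu h1 h2)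

/-! ## §3 The `K`-fixed vectors of `C` lie in the closed span of the `K`-fixed vectors of its irreducibles -/

/-- **THE `K`-FIXED VECTORS OF A CLOSED INVARIANT `C ≤ π.discretePart` LIE IN THE CLOSED SPAN OF THE `K`-FIXED VECTORS OF THE IRREDUCIBLE CLOSED SUBREPRESENTATIONS `W ≤ C`** (`π`
unitary, `K ≤ G` any subgroup).  With `T` that closed span (`T ⊆ C`, `T ⊆ Fix K`): `ψ := φ − P_T φ` lies in `C`, is `K`-fixed and orthogonal to `T`; were `ψ ≠ 0`, Bump's lemma ★ (§2
makes `C` discretely decomposable) would give an irreducible `W ≤ C` with `proj_W ψ ≠ 0`, yet `proj_W ψ ∈ W^K ⊆ T` ★ and `‖proj_W ψ‖² = re ⟪ψ, proj_W ψ⟫ = 0`.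
[cite: Bump1997, Thm. 3.6.1 (proof, pp. 340–342)] [cite: Dixmier1977, §5.4] -/
theorem mem_closure_iSup_fixedVectors_of_le_discretePart (hπ : π.IsUnitary) {C : ClosedSubrep π} (hC : C ≤ π.discretePart) (K : Subgroup G)
    {φ : C.toSubmodule} (hφ : φ ∈ C.fixedVectors K) :
    (φ : H) ∈ (⨆ W ∈ {W : ClosedSubrep π | W ≤ C ∧ W.toContRep.IsTopIrreducible}, (W.fixedVectors K).map W.toSubmodule.subtype).topologicalClosure := by
  set S : Set (ClosedSubrep π) := {W : ClosedSubrep π | W ≤ C ∧ W.toContRep.IsTopIrreducible} with hS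
  set M : Submodule ℂ H := ⨆ W ∈ S, (W.fixedVectors K).map W.toSubmodule.subtype with hM
  set T : Submodule ℂ H := M.topologicalClosure with hT
  haveI : T.HasOrthogonalProjection := Submodule.HasOrthogonalProjection.ofCompleteSpace _
  -- `T ⊆ C` and `T ⊆ Fix K`
  have hMC : M ≤ C.toSubmodule := iSup₂_le fun W hW => Submodule.map_le_iff_le_comap.2 fun w _ => hW.1 w.2
  have hTC : T ≤ C.toSubmodule := M.topologicalClosure_minimal hMC C.isClosed
  set F : Submodule ℂ H := π.toRepresentation.fixedPoints K with hF
  have hFmem : ∀ u : H, u ∈ F ↔ ∀ k ∈ K, π k u = u := fun u => by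
    rw [hF, Representation.mem_fixedPoints]; rfl
  have hFclosed : IsClosed (F : Set H) := by
    have hset : (F : Set H) = ⋂ k ∈ K, {u : H | π k u = u} := by
      ext u
      simp only [SetLike.mem_coe, hFmem, Set.mem_iInter, Set.mem_setOf_eq]
    rw [hset]
    exact isClosed_biInter fun k _ => isClosed_eq (π k).continuous continuous_id
  have hMF : M ≤ F := by
    refine iSup₂_le fun W _ => Submodule.map_le_iff_le_comap.2 fun w hw => ?_
    rw [Submodule.mem_comap, hFmem]
    intro k hk
    have h := (W.mem_fixedVectors K w).1 hw k hk
    exact congrArg Subtype.val h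
  have hTF : T ≤ F := M.topologicalClosure_minimal hMF hFclosed
  -- the `K`-fixed vector `ψ := φ − P_T φ ∈ C ∩ Tᗮ`
  have hφF : (φ : H) ∈ F := by
    rw [hFmem]
    intro k hk
    have h := (C.mem_fixedVectors K φ).1 hφ k hk
    exact congrArg Subtype.val h
  set ψ : H := (φ : H) - T.starProjection (φ : H) with hψ
  have hψT : ψ ∈ Tᗮ := T.sub_starProjection_mem_orthogonal (φ : H)
  have hψC : ψ ∈ C := C.toSubmodule.sub_mem φ.2 (hTC (T.starProjection_apply_mem (φ : H)))
  have hψF : ψ ∈ F := F.sub_mem hφF (hTF (T.starProjection_apply_mem (φ : H)))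
  by_contra hφT
  have hψ0 : ψ ≠ 0 := fun h0 => hφT (by
    have h' : (φ : H) = T.starProjection (φ : H) := sub_eq_zero.1 h0
    rw [h']
    exact T.starProjection_apply_mem (φ : H))
  -- Bump's lemma inside `C` (discretely decomposable by §2)
  obtain ⟨W, hWC, hWirr, hproj⟩ := C.exists_isTopIrreducible_orthogonalProjectionOnto_ne_zero
    (isDiscretelyDecomposable_toContRep_of_le_discretePart hπ hC) hψC hψ0
  have hψfix : (⟨ψ, hψC⟩ : C.toSubmodule) ∈ C.fixedVectors K := by
    rw [C.mem_fixedVectors]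
    intro k hk
    exact Subtype.ext ((hFmem ψ).1 hψF k hk)
  have hmemW : W.toSubmodule.orthogonalProjectionOnto ψ ∈ W.fixedVectors K :=
    Literature.NumberTheory.Automorphic.orthogonalProjectionOnto_mem_fixedVectors hπ C W K hψfix
  -- hence `proj_W ψ ∈ M ⊆ T`, orthogonal to `ψ`
  have hmemM : ((W.toSubmodule.orthogonalProjectionOnto ψ : W.toSubmodule) : H) ∈ M := by
    refine (le_iSup₂ (f := fun (W : ClosedSubrep π) (_ : W ∈ S) => (W.fixedVectors K).map W.toSubmodule.subtype) W ⟨hWC, hWirr⟩) ?_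
    exact Submodule.mem_map_of_mem hmemW
  have hmemT : ((W.toSubmodule.orthogonalProjectionOnto ψ : W.toSubmodule) : H) ∈ T := M.le_topologicalClosure hmemM
  have h0 : ⟪((W.toSubmodule.orthogonalProjectionOnto ψ : W.toSubmodule) : H), ψ⟫_ℂ = 0 := Submodule.inner_right_of_mem_orthogonal hmemT hψT
  -- but `⟪p, ψ⟫ = ‖p‖²` for the projection `p`
  set p : H := ((W.toSubmodule.orthogonalProjectionOnto ψ : W.toSubmodule) : H) with hp
  have hpW : p = W.toSubmodule.starProjection ψ := Submodule.coe_orthogonalProjectionOnto_apply _ _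
  have hself : ⟪p, ψ⟫_ℂ = ⟪p, p⟫_ℂ := by
    have hsplit : ψ = p + (ψ - p) := by abel
    conv_lhs => rw [hsplit]
    rw [inner_add_right, hpW, Submodule.inner_right_of_mem_orthogonal (W.toSubmodule.starProjection_apply_mem ψ)
      (W.toSubmodule.sub_starProjection_mem_orthogonal ψ), add_zero]
  rw [hself, inner_self_eq_zero] at h0
  exact hproj (Subtype.ext h0)

end Generic

/-! ## §4 The CM instance: `L²_res(U(Φ_N))` -/

section CM

variable (L : Type) [Field L] [NumberField L] [IsCMField L] (N : ℕ)
  (μ : Measure (UnitaryGroup.cmDatum L N (Matrix.of fun i j : Fin N => if i.val + j.val + 1 = N then (1 : L) else 0)).automorphicQuotient)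
  [(UnitaryGroup.cmDatum L N (Matrix.of fun i j : Fin N => if i.val + j.val + 1 = N then (1 : L) else 0)).IsAutomorphicMeasure μ]

/-- **THE `K`-FIXED VECTORS OF `L²_res(U(Φ_N))` LIE IN THE CLOSED SPAN OF THE `K`-FIXED VECTORS OF THE IRREDUCIBLE CLOSED SUBREPRESENTATIONS `Π ≤ L²_res`** (every subgroup `K` of
`U(Φ_N)(𝔸_{L⁺})`; §3 at `C = L²_res ≤ L²_disc` ★ `residualSubspace_le_discreteSpectrum`, ★ `isUnitary_rightRegular`) — the (DISC) letter of T9. [cite: MoeglinWaldspurger1995, I.2.18] [cite: Bump1997, Thm. 3.6.1] -/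
theorem mem_closure_iSup_fixedVectors_cmResidualSubspaceR
    (K : Subgroup (UnitaryGroup.cmDatum L N (Matrix.of fun i j : Fin N => if i.val + j.val + 1 = N then (1 : L) else 0)).Adelic)
    {φ : (cmResidualSubspaceR L N μ).toSubmodule}
    (hφ : φ ∈ (cmResidualSubspaceR L N μ).fixedVectors K) :
    (φ : Lp ℂ 2 μ) ∈ (⨆ W ∈ {W : ClosedSubrep ((UnitaryGroup.cmDatum L N (Matrix.of fun i j : Fin N => if i.val + j.val + 1 = N then (1 : L) else 0)).rightRegular μ) |
        W ≤ cmResidualSubspaceR L N μ ∧ W.toContRep.IsTopIrreducible},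
      (W.fixedVectors K).map W.toSubmodule.subtype).topologicalClosure :=
  mem_closure_iSup_fixedVectors_of_le_discretePart ((UnitaryGroup.cmDatum L N _).isUnitary_rightRegular μ)
    (Summit.HodgeConjecture.HodgeConjecture.Cruxes.H413.K2E1CuspidalSpectrumUnitary.residualSubspace_le_discreteSpectrum _ μ _) K hφ

end CM


/-! ## §5 (ED. 2) The same in T9's binder bytes: `K` any `SetLike` subset, `Kfix` any submodule with `v ∈ Kfix ↔ ∀ k ∈ K, π k v = v`, pieces `W.toSubmodule ⊓ Kfix` -/

section LetterBytes

variable {G H : Type*} [Group G] [NormedAddCommGroup H] [InnerProductSpace ℂ H] [CompleteSpace H] {π : ContRepresentation ℂ G H}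

/-- **T9's LETTER `hdisc`, ABSTRACT FORM** (K2E1-p12 (g0) 10:49:44Z bytes): for `π` unitary, `C ≤ π.discretePart` closed invariant, `K` any set-like family of group elements and `Kfix` the
submodule of `K`-fixed vectors, every `K`-fixed `v ∈ C` lies in the closure of `⨆_{W ≤ C irreducible} (W ⊓ Kfix)` — §3 at the subgroup generated by `K` (a vector fixed by `K` is fixed by
`Subgroup.closure K`), then monotonicity of the closed span. [cite: Dixmier1977, §5.4] [cite: Bump1997, Thm. 3.6.1 (proof, pp. 340–342)] -/
theorem mem_closure_iSup_inf_of_le_discretePart (hπ : π.IsUnitary) {C : ClosedSubrep π} (hC : C ≤ π.discretePart)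
    {S : Type*} [SetLike S G] (K : S) (Kfix : Submodule ℂ H) (hKfix : ∀ v, v ∈ Kfix ↔ ∀ k ∈ K, π k v = v) :
    ∀ v ∈ C, (∀ k ∈ K, π k v = v) →
      v ∈ (⨆ W ∈ {W : ClosedSubrep π | W ≤ C ∧ W.toContRep.IsTopIrreducible}, W.toSubmodule ⊓ Kfix).topologicalClosure := by
  intro v hvC hvK
  -- the subgroup generated by `K` fixes `v`
  set K' : Subgroup G := Subgroup.closure (K : Set G) with hK'
  have hstab : ∀ {u : H}, (∀ k ∈ K, π k u = u) → ∀ g ∈ K', π g u = u := by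
    intro u hu g hg
    refine Subgroup.closure_induction (p := fun g _ => π g u = u) (fun k hk => hu k hk) (by rw [map_one]; rfl)
      (fun a b _ _ ha hb => by rw [map_mul]; exact (show π a (π b u) = u by rw [hb, ha])) (fun a _ ha => ?_) hg
    calc π a⁻¹ u = π a⁻¹ (π a u) := by rw [ha]
      _ = (π a⁻¹ * π a) u := rfl
      _ = u := by rw [← map_mul, inv_mul_cancel, map_one]; rfl
  have hφ : (⟨v, hvC⟩ : C.toSubmodule) ∈ C.fixedVectors K' := by
    rw [C.mem_fixedVectors]
    intro g hg
    exact Subtype.ext (hstab hvK g hg)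
  have hmem := mem_closure_iSup_fixedVectors_of_le_discretePart hπ hC K' hφ
  -- monotonicity: `ι_W(W^{K'}) ≤ W ⊓ Kfix`
  refine (Submodule.topologicalClosure_mono ?_) hmem
  refine iSup₂_mono fun W _ => Submodule.map_le_iff_le_comap.2 fun w hw => ?_
  rw [Submodule.mem_comap, Submodule.coe_subtype, Submodule.mem_inf, hKfix]
  refine ⟨w.2, fun k hk => ?_⟩
  have h := (W.mem_fixedVectors K' w).1 hw k (Subgroup.subset_closure hk)
  exact congrArg Subtype.val h

end LetterBytes

section CMLetterBytes

variable (L : Type) [Field L] [NumberField L] [IsCMField L] (N : ℕ)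
  (μ : Measure (UnitaryGroup.cmDatum L N (Matrix.of fun i j : Fin N => if i.val + j.val + 1 = N then (1 : L) else 0)).automorphicQuotient)
  [(UnitaryGroup.cmDatum L N (Matrix.of fun i j : Fin N => if i.val + j.val + 1 = N then (1 : L) else 0)).IsAutomorphicMeasure μ]

/-- **T9's LETTER `hdisc` AT `L²_res(U(Φ_N))`, IN ITS BINDER BYTES** (K2E1-p12 (g0) §3∕§4, 10:49:44Z): for every `K_U ≤ U(Φ_N)(𝔸_{L⁺})` and every submodule `Kfix` of `K_U`-fixed vectors,
`∀ v ∈ (L²_res).toSubmodule, (∀ k ∈ K_U, R(k) v = v) → v ∈ (⨆ W ∈ {W | W ≤ L²_res ∧ W irreducible}, W.toSubmodule ⊓ Kfix).topologicalClosure`. [cite: MoeglinWaldspurger1995, I.2.18] [cite: Bump1997, Thm. 3.6.1] -/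
theorem cmResidualSubspaceR_fixed_mem_closure_iSup_inf
    (K_U : Subgroup (UnitaryGroup.cmDatum L N (Matrix.of fun i j : Fin N => if i.val + j.val + 1 = N then (1 : L) else 0)).Adelic) (Kfix : Submodule ℂ (Lp ℂ 2 μ))
    (hKfix : ∀ v, v ∈ Kfix ↔ ∀ k ∈ K_U, ((UnitaryGroup.cmDatum L N (Matrix.of fun i j : Fin N => if i.val + j.val + 1 = N then (1 : L) else 0)).rightRegular μ) k v = v) :
    ∀ v ∈ (cmResidualSubspaceR L N μ).toSubmodule,
      (∀ k ∈ K_U, ((UnitaryGroup.cmDatum L N (Matrix.of fun i j : Fin N => if i.val + j.val + 1 = N then (1 : L) else 0)).rightRegular μ) k v = v) →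
        v ∈ (⨆ W ∈ {W : ClosedSubrep ((UnitaryGroup.cmDatum L N (Matrix.of fun i j : Fin N => if i.val + j.val + 1 = N then (1 : L) else 0)).rightRegular μ) |
            W ≤ cmResidualSubspaceR L N μ ∧ W.toContRep.IsTopIrreducible}, W.toSubmodule ⊓ Kfix).topologicalClosure :=
  mem_closure_iSup_inf_of_le_discretePart ((UnitaryGroup.cmDatum L N _).isUnitary_rightRegular μ)
    (Summit.HodgeConjecture.HodgeConjecture.Cruxes.H413.K2E1CuspidalSpectrumUnitary.residualSubspace_le_discreteSpectrum _ μ _) K_U Kfix hKfix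

end CMLetterBytes

end Summit.HodgeConjecture.HodgeConjecture.Cruxes.H413.K2E1ResidualFixedVectorsDiscreteClosureU

end
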